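import Literature.AlgebraicGeometry.Resolution.Kuhlmann2019HenselianRationalitySteps
import Literature.AlgebraicGeometry.Resolution.GeneralizedStabilityLemma55VT
import Literature.AlgebraicGeometry.Resolution.HenselizedFunctionFieldsImmediate
import Mathlib.FieldTheory.IsSepClosed
import Mathlib.GroupTheory.SpecificGroups.Cyclic
import HarnessLib

/-!
# Lemmas for the assembly of Kuhlmann 2019, Prop. 5.7 (henselian rationality, arbitrary rank)

Topic: `Literature/AlgebraicGeometry/Resolution` (valued function fields). PROVED valuation
theory used by `Kuhlmann2019HenselianRationalityProofs.lean` to assemble the named fact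
`Kuhlmann2019_Thm13_sepClosed` (`Kuhlmann2019HenselianRationality.lean` = F.-V. Kuhlmann,
*Elimination of ramification II*, Israel J. Math. 234 (2019) = arXiv:1701.05508, Thm. 1.3 for
a separably closed ground field) from the ingredients of the printed proof of Prop. 5.7
(`Kuhlmann2019HenselianRationalitySteps.lean`). Ambient rendering throughout: one valued field
`(Ω, V)`, subfields `M ≤ N ≤ Ω` valued by restriction.

## Content (everything PROVED, [folklore] unless a source is named)

* `relfinrank_eq_relIndex_mul_relfinrank_of_isSeparablyDefectlessField` — **over a henselian,
  separably defectless `(L, V ∩ L)`, a finite separable `E ≥ L` has `[E : L] = (vE : vL)[Ev : Lv]`**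
  (Kuhlmann 2010, §1: "`g = 1` if `(K,v)` is henselian", and the definition of "separably
  defectless"): the form in which Prop. 5.7's proof consumes "[16, Theorem 1] … [4, (18.2)] …
  Hence the extension `F₀^h|K₀(x)^h` must be trivial".
* `exists_valuation_pow_relIndex_eq` — `v(a)^{(vE : vL)} ∈ vL` for `a ∈ E^×`;
  `valueSubgroup_eq_of_forall_valuation_eq`, `residueSubfield_eq_of_resField_le` — `e = 1`,
  `f = 1` from "every value / residue of `E` is one of `L`".
* `exists_value_generator` — **"`vF₀/vK₀` torsion free of rational rank 1 and finitely
  generated ⇒ `vF₀ = vK₀ ⊕ ℤvx`"** in the form needed: if `x ∈ T` is value-transcendental over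
  `K₀ ≤ T`, every `v(b)^e`, `b ∈ T^×`, lies in `vK₀·⟨vx⟩` for one `e ≥ 1`, and `vT/vK₀` is
  torsion free, then `vT = vK₀·⟨vx'⟩` for some `x' ∈ T` (the exponent map `T^× → ℤ` has cyclic
  image).
* `isSepClosed_of_relAlgClosed` — a relatively algebraically closed subfield of a separably
  closed field is separably closed; `mem_of_isAlgebraic_of_isAlgClosed_subfield` — an
  algebraically closed subfield contains the elements algebraic over it;
  `exists_valuation_ne_one_of_isImmediateOver` — an immediate `F|K` with `F ≠ K` is
  non-trivially valued on `K`; `relfinrank_closure_pos` — `[L(s) : L]` is finite for a finite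
  set `s` of integral elements; `exists_transcendental_le_henselization` — the last lines of
  the proof of Prop. 5.7 ("`F^h = (F₀.K)^h = … = K(x)^h`").

## Sources

* F.-V. Kuhlmann, Israel J. Math. 234 (2019) = arXiv:1701.05508, proof of Prop. 5.7 (p. 14).
* F.-V. Kuhlmann, Trans. AMS 362 (2010) = arXiv:1003.5678, §1 (p. 3), Lemma 2.5.
-/

noncomputable section

open IsLocalRing

namespace Literature.AlgebraicGeometry.Resolution

universe u

variable {Ω : Type u} [Field Ω] {V : ValuationSubring Ω}

/-! ### `e`, `f` and `[E : L]` over a henselian separably defectless subfield -/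

section Degree

variable (V)

/-- **`vE = vL` from values**: if every value of `E^×` is a value of `L` (`L ≤ E`), the value
subgroups agree. [folklore] -/
theorem valueSubgroup_eq_of_forall_valuation_eq {L E : Subfield Ω} (hle : L ≤ E)
    (hv : ∀ a ∈ E, a ≠ 0 → ∃ b ∈ L, V.valuation a = V.valuation b) :
    valueSubgroup E V = valueSubgroup L V := by
  refine le_antisymm (fun γ hγ => ?_) (valueSubgroup_subfield_mono hle)
  obtain ⟨c, hc0, hγc⟩ := (mem_valueSubgroup_iff E V γ).mp hγ
  have hc0' : (c : Ω) ≠ 0 := fun h0 => hc0 (Subtype.ext h0)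
  obtain ⟨b, hbL, hb⟩ := hv c c.2 hc0'
  refine (mem_valueSubgroup_iff L V γ).mpr ⟨⟨b, hbL⟩, ?_, ?_⟩
  · intro hb0
    have hb0' : b = 0 := congrArg Subtype.val hb0
    rw [hb0', map_zero, map_eq_zero] at hb
    exact hc0' hb
  · rw [hγc]
    exact hb

/-- **`Ev = Lv` from residues**: if every residue of `V ∩ E` is a residue of `V ∩ L` (`L ≤ E`),
the residue subfields agree. [folklore] -/
theorem residueSubfield_eq_of_resField_le {L E : Subfield Ω} (hle : L ≤ E)
    (hr : resField V E ≤ resField V L) : residueSubfield E V = residueSubfield L V := by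
  refine le_antisymm ?_ (residueSubfield_subfield_mono hle)
  rw [residueSubfield_subfield_eq_resField, residueSubfield_subfield_eq_resField]
  exact hr

/-- **`v(a)^e ∈ vL` for `e = (vE : vL)`** and `a ∈ E^×` (Lagrange in `vE/vL`; with `e = 0` for
an infinite index the statement is trivial). [folklore] -/
theorem exists_valuation_pow_relIndex_eq {L E : Subfield Ω} {a : Ω} (ha : a ∈ E) (ha0 : a ≠ 0) :
    ∃ b ∈ L, b ≠ 0 ∧
      V.valuation a ^ (valueSubgroup L V).relIndex (valueSubgroup E V) = V.valuation b := by
  have hva : V.valuation a ≠ 0 := (map_ne_zero _).mpr ha0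
  set γ : (ValuationSubring.ValueGroup V)ˣ := Units.mk0 _ hva with hγ
  have hγE : γ ∈ valueSubgroup E V :=
    (mem_valueSubgroup_iff E V γ).mpr ⟨⟨a, ha⟩, fun h0 => ha0 (congrArg Subtype.val h0), rfl⟩
  have hmem := Subgroup.pow_index_mem ((valueSubgroup L V).subgroupOf (valueSubgroup E V))
    ⟨γ, hγE⟩
  rw [Subgroup.mem_subgroupOf, SubgroupClass.coe_pow] at hmem
  obtain ⟨c, hc0, hc⟩ := (mem_valueSubgroup_iff L V _).mp hmem
  refine ⟨c, c.2, fun h0 => hc0 (Subtype.ext h0), ?_⟩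
  have hc' : ((γ ^ ((valueSubgroup L V).subgroupOf (valueSubgroup E V)).index :
      (ValuationSubring.ValueGroup V)ˣ) : ValuationSubring.ValueGroup V) =
      V.valuation (algebraMap L Ω c) := hc
  rw [Units.val_pow_eq_pow_val, hγ, Units.val_mk0] at hc'
  exact hc'

/-- **Over a henselian, separably defectless `(L, V ∩ L)`: `[E : L] = (vE : vL)·[Ev : Lv]` for
every finite separable `E ≥ L` inside `Ω`** (Kuhlmann 2010, §1: for a henselian field the
extension of the valuation is unique, `g = 1`, so "defectless in `E`" reads `[E : L] = e·f`;
"separably defectless" = defectless in every finite separable extension). PROVED: the unique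
valuation ring of `E` over `V ∩ L` is `V ∩ E` (`IsHenselianField`), whose `e` and `f` are the
relative index of `vL ≤ vE` and the relative degree of `Lv ≤ Ev` (`DefectAmbient.lean`).
[cite: Kuhlmann2010, Section 1 (p. 3 of arXiv:1003.5678)] -/
theorem relfinrank_eq_relIndex_mul_relfinrank_of_isSeparablyDefectlessField {L E : Subfield Ω}
    (hle : L ≤ E) (hLh : IsHenselianField L (V.comap (algebraMap L Ω)))
    (hsd : IsSeparablyDefectlessField L (V.comap (algebraMap L Ω)))
    (hpos : 0 < Subfield.relfinrank L E) (hsep : ∀ a ∈ E, IsSeparable L a) :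
    Subfield.relfinrank L E =
      (valueSubgroup L V).relIndex (valueSubgroup E V) *
        (residueSubfield L V).relfinrank (residueSubfield E V) := by
  classical
  set E' : IntermediateField L Ω := Subfield.extendScalars hle with hE'
  have hfr : Subfield.relfinrank L E = Module.finrank L E' := Subfield.relfinrank_eq_finrank_of_le hle
  haveI : FiniteDimensional L E' := by
    rw [hfr] at hpos
    exact Module.finite_of_finrank_pos hpos
  haveI : Algebra.IsAlgebraic L E' := Algebra.IsAlgebraic.of_finite L E'
  haveI : Algebra.IsSeparable L E' := by
    refine ⟨fun y => ?_⟩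
    have hy : IsSeparable L (y : Ω) := hsep y y.2
    change (minpoly L y).Separable
    rw [IntermediateField.minpoly_eq]
    exact hy
  -- the unique extension of `V ∩ L` to `E'`
  set W : ValuationSubring E' := V.comap (algebraMap E' Ω) with hW
  have hover : W.comap (algebraMap L E') = V.comap (algebraMap L Ω) := by
    rw [hW, ValuationSubring.comap_comap, ← IsScalarTower.algebraMap_eq]
  obtain ⟨s, hs, hsum⟩ := hsd E' inferInstance inferInstance
  have hsW : s = {W} := by
    ext O'
    rw [Finset.mem_singleton, hs O']
    constructor
    · intro hO'
      exact hLh E' inferInstance O' W hO' hover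
    · rintro rfl
      exact hover
  rw [hsW, Finset.sum_singleton] at hsum
  have hrange : Set.range (algebraMap E' Ω) = Set.range (algebraMap E Ω) := by
    rw [range_algebraMap_intermediateField, range_algebraMap_subfield, hE', Subfield.coe_extendScalars]
  rw [hfr, ← hsum, hW, ramificationIndex_comap_eq_relIndex, inertiaDegree_comap_eq_relfinrank,
    valueSubgroup_eq_of_range_eq V hrange, residueSubfield_eq_of_range_eq V hrange]

/-- **The kill**: over a henselian, separably defectless `(L, V ∩ L)`, a finite separable
`E ≥ L` with `vE = vL` and `Ev = Lv` equals `L` ("Hence the extension `F₀^h|K₀(x)^h` must be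
trivial", proof of Prop. 5.7). [cite: Kuhlmann2019, Prop. 5.7 (proof)] -/
theorem eq_of_isSeparablyDefectlessField_of_immediate {L E : Subfield Ω} (hle : L ≤ E)
    (hLh : IsHenselianField L (V.comap (algebraMap L Ω)))
    (hsd : IsSeparablyDefectlessField L (V.comap (algebraMap L Ω)))
    (hpos : 0 < Subfield.relfinrank L E) (hsep : ∀ a ∈ E, IsSeparable L a)
    (hv : ∀ a ∈ E, a ≠ 0 → ∃ b ∈ L, V.valuation a = V.valuation b)
    (hr : resField V E ≤ resField V L) : E = L := by
  have h := relfinrank_eq_relIndex_mul_relfinrank_of_isSeparablyDefectlessField V hle hLh hsd hpos hsep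
  rw [valueSubgroup_eq_of_forall_valuation_eq V hle hv, residueSubfield_eq_of_resField_le V hle hr,
    Subgroup.relIndex_self, Subfield.relfinrank_self, mul_one] at h
  exact le_antisymm (Subfield.relfinrank_eq_one_iff.mp h) hle

end Degree

/-! ### A cyclic value group modulo `vK₀` -/

section Generator

/-- **`vT = vK₀ ⊕ ℤ·vx'` from a finite exponent.** Let `K₀ ≤ T` be subfields of `(Ω, V)` and
`x ∈ T` value-transcendental over `K₀`. If for one `e ≥ 1` every `v(b)^e`, `b ∈ T^×`, lies in
`vK₀·⟨vx⟩`, and `vT/vK₀` is torsion free, then `vT = vK₀·⟨vx'⟩` for some `x' ∈ T^×`. PROVED: the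
exponent `m` in `v(b)^e = v(c)·v(x)^m` is unique, additive in `b`, and its values form a subgroup
of `ℤ`, hence `ℤ·g`; for `x'` with exponent `g`, `b·x'^{-k}` (`k = m/g`) has `e`-th power of value
in `vK₀`, so value in `vK₀`. (This realises "the torsion free group `vF₀/vK₀` [of rational rank 1]
is finitely generated. It follows that `vF₀ = vK₀ ⊕ ℤvx`" in the proof of Prop. 5.7.)
[cite: Kuhlmann2019, Prop. 5.7 (proof)] -/
theorem exists_value_generator {K₀ T : Subfield Ω} {x : Ω} (hxT : x ∈ T)
    (hx : IsValueTranscendentalOver V K₀ x) {e : ℕ} (he : 0 < e)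
    (hidx : ∀ b ∈ T, b ≠ 0 → ∃ c ∈ K₀, c ≠ 0 ∧ ∃ m : ℤ,
      V.valuation b ^ e = V.valuation c * V.valuation x ^ m)
    (htf : ∀ b ∈ T, b ≠ 0 → ∀ n : ℕ, 0 < n → (∃ c ∈ K₀, V.valuation b ^ n = V.valuation c) →
      ∃ c ∈ K₀, V.valuation b = V.valuation c) :
    ∃ x' ∈ T, x' ≠ 0 ∧ ∀ b ∈ T, b ≠ 0 → ∃ c ∈ K₀, c ≠ 0 ∧ ∃ m : ℤ,
      V.valuation b = V.valuation c * V.valuation x' ^ m := by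
  have hx0 : V.valuation x ≠ 0 := (map_ne_zero _).mpr hx.ne_zero
  -- uniqueness of the exponent
  have huniq : ∀ {c c' : Ω}, c ∈ K₀ → c' ∈ K₀ → c ≠ 0 → c' ≠ 0 → ∀ {m m' : ℤ},
      V.valuation c * V.valuation x ^ m = V.valuation c' * V.valuation x ^ m' → m = m' := by
    intro c c' hc hc' hc0 hc0' m m' h
    by_contra hne
    have hvc : V.valuation c ≠ 0 := (map_ne_zero _).mpr hc0
    have hvc' : V.valuation c' ≠ 0 := (map_ne_zero _).mpr hc0'
    have key : V.valuation x ^ (m - m') = V.valuation (c' / c) := by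
      rw [zpow_sub₀ hx0, map_div₀, div_eq_div_iff (zpow_ne_zero _ hx0) hvc]
      calc V.valuation x ^ m * V.valuation c = V.valuation c * V.valuation x ^ m := mul_comm _ _
        _ = V.valuation c' * V.valuation x ^ m' := h
    exact hx.zpow_ne (sub_ne_zero.mpr hne) (div_mem hc' hc) key
  -- the set of exponents is a subgroup of `ℤ`
  let Φ : AddSubgroup ℤ :=
    { carrier := {m | ∃ b ∈ T, b ≠ 0 ∧ ∃ c ∈ K₀, c ≠ 0 ∧
        V.valuation b ^ e = V.valuation c * V.valuation x ^ m}
      zero_mem' := ⟨1, T.one_mem, one_ne_zero, 1, K₀.one_mem, one_ne_zero, by simp⟩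
      add_mem' := by
        rintro m₁ m₂ ⟨b₁, hb₁, hb₁0, c₁, hc₁, hc₁0, h₁⟩ ⟨b₂, hb₂, hb₂0, c₂, hc₂, hc₂0, h₂⟩
        refine ⟨b₁ * b₂, T.mul_mem hb₁ hb₂, mul_ne_zero hb₁0 hb₂0, c₁ * c₂, K₀.mul_mem hc₁ hc₂,
          mul_ne_zero hc₁0 hc₂0, ?_⟩
        rw [map_mul, mul_pow, h₁, h₂, map_mul, zpow_add₀ hx0]
        exact mul_mul_mul_comm _ _ _ _
      neg_mem' := by
        rintro m ⟨b, hb, hb0, c, hc, hc0, h⟩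
        refine ⟨b⁻¹, T.inv_mem hb, inv_ne_zero hb0, c⁻¹, K₀.inv_mem hc, inv_ne_zero hc0, ?_⟩
        rw [map_inv₀, inv_pow, h, map_inv₀, mul_inv, zpow_neg] }
  have hmemΦ : ∀ {m : ℤ}, m ∈ Φ ↔ ∃ b ∈ T, b ≠ 0 ∧ ∃ c ∈ K₀, c ≠ 0 ∧
      V.valuation b ^ e = V.valuation c * V.valuation x ^ m := fun {m} => Iff.rfl
  have heΦ : (e : ℤ) ∈ Φ :=
    hmemΦ.mpr ⟨x, hxT, hx.ne_zero, 1, K₀.one_mem, one_ne_zero, by rw [map_one, one_mul, zpow_natCast]⟩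
  -- `Φ = ℤ·g`
  obtain ⟨⟨g, hgΦ⟩, hg⟩ := IsAddCyclic.exists_generator (α := Φ)
  have hgen : ∀ m ∈ Φ, ∃ k : ℤ, m = k * g := fun m hm => by
    obtain ⟨k, hk⟩ := AddSubgroup.mem_zmultiples_iff.mp (hg ⟨m, hm⟩)
    refine ⟨k, ?_⟩
    have := congrArg Subtype.val hk
    simpa [mul_comm] using this.symm
  obtain ⟨x', hx'T, hx'0, c', hc', hc'0, hx'⟩ := hmemΦ.mp hgΦ
  have hvx' : V.valuation x' ≠ 0 := (map_ne_zero _).mpr hx'0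
  have hvc' : V.valuation c' ≠ 0 := (map_ne_zero _).mpr hc'0
  refine ⟨x', hx'T, hx'0, fun b hbT hb0 => ?_⟩
  obtain ⟨c, hc, hc0, m, hm⟩ := hidx b hbT hb0
  have hvc : V.valuation c ≠ 0 := (map_ne_zero _).mpr hc0
  obtain ⟨k, rfl⟩ := hgen m (hmemΦ.mpr ⟨b, hbT, hb0, c, hc, hc0, hm⟩)
  -- `b'' = b · x'^{-k}` has `v(b'')^e ∈ vK₀`
  set b'' : Ω := b * x' ^ (-k) with hb''
  have hb''T : b'' ∈ T := T.mul_mem hbT (zpow_mem hx'T _)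
  have hb''0 : b'' ≠ 0 := mul_ne_zero hb0 (zpow_ne_zero _ hx'0)
  have h1 : (V.valuation x' ^ (-k)) ^ e = V.valuation c' ^ (-k) * V.valuation x ^ (-(k * g)) := by
    rw [← zpow_natCast, ← zpow_mul, mul_comm, zpow_mul, zpow_natCast, hx', mul_zpow, ← zpow_mul,
      mul_neg, mul_comm g k]
  have hpow : V.valuation b'' ^ e = V.valuation (c * c' ^ (-k)) := by
    rw [hb'', map_mul, map_zpow₀, mul_pow, h1, hm, map_mul, map_zpow₀, mul_mul_mul_comm,
      ← zpow_add₀ hx0, add_neg_cancel, zpow_zero, mul_one]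
  obtain ⟨c₂, hc₂, hb''c₂⟩ :=
    htf b'' hb''T hb''0 e he ⟨c * c' ^ (-k), K₀.mul_mem hc (zpow_mem hc' _), hpow⟩
  have hc₂0 : c₂ ≠ 0 := by
    rintro rfl
    rw [map_zero, map_eq_zero] at hb''c₂
    exact hb''0 hb''c₂
  refine ⟨c₂, hc₂, hc₂0, k, ?_⟩
  rw [← hb''c₂, hb'', map_mul, map_zpow₀, mul_assoc, ← zpow_add₀ hvx', neg_add_cancel, zpow_zero,
    mul_one]

end Generator

/-! ### Separably closed subfields, residues, non-triviality -/

section Fields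

/-- **A relatively algebraically closed subfield `K₀` of a separably closed field `K` is
separably closed**: a separable irreducible polynomial over `K₀` has a root in `K`, which is
algebraic over `K₀` and so lies in `K₀`. [folklore] -/
theorem isSepClosed_of_relAlgClosed {K₀ K : Subfield Ω} (hle : K₀ ≤ K) [hK : IsSepClosed K]
    (hrac : ∀ a ∈ K, IsAlgebraic K₀ a → a ∈ K₀) : IsSepClosed K₀ := by
  refine IsSepClosed.of_exists_root K₀ fun p hmon hirr hsep => ?_
  let ι : K₀ →+* K := Subfield.inclusion hle
  have hdeg : (p.map ι).degree ≠ 0 := by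
    rw [Polynomial.degree_map]
    exact (Polynomial.degree_pos_of_irreducible hirr).ne'
  obtain ⟨r, hr⟩ := IsSepClosed.exists_root (p.map ι) hdeg (hsep.map)
  -- `r ∈ K` is a root of `p`, hence algebraic over `K₀`, hence in `K₀`
  have hcomp : (algebraMap K Ω).comp ι = algebraMap K₀ Ω := RingHom.ext fun _ => rfl
  have hrΩ : Polynomial.aeval (r : Ω) p = 0 := by
    have hr' : (p.map ι).eval r = 0 := hr
    rw [Polynomial.eval_map] at hr'
    have := congrArg (algebraMap K Ω) hr'
    rw [Polynomial.hom_eval₂, hcomp, map_zero] at this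
    exact this
  have halg : IsAlgebraic K₀ (r : Ω) := ⟨p, hmon.ne_zero, hrΩ⟩
  have hrK₀ : (r : Ω) ∈ K₀ := hrac r r.2 halg
  refine ⟨⟨r, hrK₀⟩, ?_⟩
  apply (algebraMap K₀ Ω).injective
  rw [← Polynomial.aeval_algebraMap_apply_eq_algebraMap_eval, map_zero]
  exact hrΩ

/-- **An algebraically closed subfield contains every element algebraic over it** (the minimal
polynomial of such an element is irreducible, hence linear). [folklore] -/
theorem mem_of_isAlgebraic_of_isAlgClosed_subfield {k : Type*} [Field k] (k₀ : Subfield k)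
    [IsAlgClosed k₀] {r : k} (hr : IsAlgebraic k₀ r) : r ∈ k₀ := by
  have hint : IsIntegral k₀ r := hr.isIntegral
  have hdeg : (minpoly k₀ r).degree = 1 :=
    IsAlgClosed.degree_eq_one_of_irreducible k₀ (minpoly.irreducible hint)
  obtain ⟨c, hc⟩ := minpoly.mem_range_of_degree_eq_one k₀ r hdeg
  rw [← hc]
  exact c.2

variable (V)

/-- **An immediate extension with a new element is non-trivially valued on the base**: if
`(F|K, V)` is immediate and `t ∈ F ∖ K`, some `c ∈ K^×` has `v(c) ≠ 1` (otherwise all of `F^×`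
has value `1`, `F ⊆ V`, and `t` would share its residue with some `b ∈ K`, forcing `t = b`).
The remark "The valuation `v` is nontrivial on `K` since otherwise `F = K` because `(F|K,v)` is
immediate" of Kuhlmann 2019, proof of Prop. 5.2. [cite: Kuhlmann2019, Prop. 5.2 (proof)] -/
theorem exists_valuation_ne_one_of_isImmediateOver {K F : Subfield Ω} (hKF : K ≤ F)
    (himm : IsImmediateOver V K F) {t : Ω} (htF : t ∈ F) (htK : t ∉ K) :
    ∃ c ∈ K, c ≠ 0 ∧ V.valuation c ≠ 1 := by
  by_contra h
  push Not at h
  have hF1 : ∀ a ∈ F, a ≠ 0 → V.valuation a = 1 := fun a ha ha0 => by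
    obtain ⟨b, hbK, hab⟩ := himm.1 a ha ha0
    have hb0 : b ≠ 0 := by
      rintro rfl
      rw [map_zero, map_eq_zero] at hab
      exact ha0 hab
    rw [hab, h b hbK hb0]
  have ht0 : t ≠ 0 := fun h0 => htK (h0 ▸ K.zero_mem)
  have htV : t ∈ V := (V.valuation_le_one_iff t).mp (hF1 t htF ht0).le
  obtain ⟨b, hbK, hb⟩ := (mem_resField_iff V K _).mp (himm.2 (residue_mem_resField V ⟨t, htV⟩ htF))
  -- `t - b` has value `< 1`, lies in `F`, hence is `0`, so `t = b ∈ K`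
  have hlt : V.valuation (t - b) < 1 := by
    have h1 : residue V ⟨t, htV⟩ - residue V b = 0 := by rw [hb, sub_self]
    rw [← map_sub, residue_eq_zero_iff, ValuationSubring.valuation_lt_one_iff] at h1
    exact h1
  have htb : t - (b : Ω) ∈ F := F.sub_mem htF (hKF hbK)
  by_cases h0 : t - (b : Ω) = 0
  · exact htK (by rw [sub_eq_zero.mp h0]; exact hbK)
  · exact absurd (hF1 _ htb h0) hlt.ne

end Fields

/-! ### Finite generation and the last lines of the proof of Prop. 5.7 -/

section Final

/-- `[L(s) : L]` is finite (positive) for a finite set `s` of elements integral over `L`.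
[folklore] -/
theorem relfinrank_closure_pos (L : Subfield Ω) (s : Finset Ω) (hs : ∀ a ∈ s, IsIntegral L a) :
    0 < Subfield.relfinrank L (Subfield.closure ((L : Set Ω) ∪ s)) := by
  have hle : L ≤ Subfield.closure ((L : Set Ω) ∪ s) := fun y hy => Subfield.subset_closure (Or.inl hy)
  rw [Subfield.relfinrank_eq_finrank_of_le hle]
  have heq : Subfield.extendScalars hle = IntermediateField.adjoin L (↑s : Set Ω) := by
    apply IntermediateField.toSubfield_injective
    rw [Subfield.extendScalars_toSubfield, adjoin_toSubfield_eq_closure]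
  rw [heq]
  haveI : Finite (↑s : Set Ω) := s.finite_toSet.to_subtype
  haveI := IntermediateField.finiteDimensional_adjoin (K := L) (S := (↑s : Set Ω))
    fun a ha => hs a (Finset.mem_coe.mp ha)
  exact Module.finrank_pos

variable (V)

/-- **The last lines of the proof of Prop. 5.7**: "If we are able to show that
`F₀^h = K₀(x)^h` for some `x ∈ F₀ ⊆ F`, then it will follow that
`F^h = (F₀.K)^h = (F₀^h.K)^h = (K₀(x)^h.K)^h = (K₀(x).K)^h = K(x)^h`." In the ambient
rendering: from `F₀ ≤ K₀(x)^h`, `K₀ ≤ K`, `F₀.K = F` we get `F ≤ K(x)^h` (monotonicity of the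
henselization, `Kuhlmann2010HenselizationIsHenselian_holds`), and `x` is transcendental over
`K` as soon as `F` contains an element transcendental over `K` (elements of `K(x)^h` are
algebraic over `K(x)`). [cite: Kuhlmann2019, Prop. 5.7 (proof)] -/
theorem exists_transcendental_le_henselization [IsAlgClosed Ω] {K K₀ F₀ F : Subfield Ω}
    (hK₀K : K₀ ≤ K) (hF₀F : F₀ ≤ F) (hsup : F₀ ⊔ K = F) {x : Ω} (hxF₀ : x ∈ F₀)
    (hle : F₀ ≤ henselization V (Subfield.closure ((K₀ : Set Ω) ∪ {x})))
    {t : Ω} (htF : t ∈ F) (ht : Transcendental K t) :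
    ∃ x ∈ F, Transcendental K x ∧ F ≤ henselization V (Subfield.closure ((K : Set Ω) ∪ {x})) := by
  set Kx : Subfield Ω := Subfield.closure ((K : Set Ω) ∪ {x}) with hKx
  have hKKx : K ≤ Kx := fun y hy => Subfield.subset_closure (Or.inl hy)
  have hFle : F ≤ henselization V Kx := by
    rw [← hsup]
    refine sup_le (hle.trans ?_) (hKKx.trans (le_henselization V Kx))
    exact henselization_mono V Kuhlmann2010HenselizationIsHenselian_holds
      (Subfield.closure_mono (Set.union_subset_union_left _ hK₀K))
  refine ⟨x, hF₀F hxF₀, fun hxalg => ht ?_, hFle⟩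
  -- if `x` were algebraic over `K`, so would be `t ∈ F ≤ K(x)^h`
  have hKx_alg : ∀ w ∈ Kx, IsAlgebraic K w := fun w hw =>
    isAlgebraic_of_mem_closure (s := ({x} : Set Ω)) (fun y hy => by
      rw [Set.mem_singleton_iff] at hy
      rw [hy]
      exact hxalg) hw
  have htKx : IsAlgebraic Kx t :=
    (isSeparable_of_mem_henselization V Kx (hFle htF)).isIntegral.isAlgebraic
  exact isAlgebraic_trans_subfield hKKx hKx_alg htKx

end Final

end Literature.AlgebraicGeometry.Resolution
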